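import Summits.MatrixMultiplication.MatrixMultiplication.Theses.HyperbolicRankMethods

/-!
# `HyperbolicRankMethods.Assembly` (stmt-MatrixMultiplication-10093) — proved

The assembly item of route `MatrixMultiplication/HyperbolicRankMethods` (refutation line) is the
implication `HypSuperquadratic → HypSoundness → SuperquadraticInfinitelyOften → ¬ MatrixMultiplication`:
a hyperbolic (Gårding-)rank method with sub-additive Gårding rank `Rank_h`, `Rank_h ≤ k` on rank-one
tensors and `k·n^(2+δ) < Rank_h(Φ⟨n,n,n⟩)` for infinitely many `n` (`HypSuperquadratic`), together
with the elementary soundness `Rank_h(Φ t) ≤ k·R(t)` (`HypSoundness`), gives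
`k·n^(2+δ) < Rank_h(Φ⟨n,n,n⟩) ≤ k·R(⟨n,n,n⟩)`, hence `n^(2+δ) < R(⟨n,n,n⟩)` infinitely often
(`lt_of_mul_lt_mul_left`, `k ≥ 0`), which is the hypothesis of the shared glue
`SuperquadraticInfinitelyOften`, whose conclusion is `¬ MatrixMultiplication`.

Proof: a few lines of logic, self-contained (it follows — but does not invoke — the route file's
deciding theorem `closes`). The cruxes `HypEscape`, `HypTwoByTwoSeven`, `HypMatMulUnbounded` and the
supports `HypBorderSoundness`, `GardingRankSubadditive` are milestones / standing inputs of the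
mechanism, not hypotheses of the assembly, and are deliberately not used here.
-/

namespace Summit.MatrixMultiplication.MatrixMultiplication.Theorems

open Literature.Computability.AlgebraicComplexity

/-- **Assembly of route `HyperbolicRankMethods` (stmt-MatrixMultiplication-10093), exact signature
`HypSuperquadratic → HypSoundness → SuperquadraticInfinitelyOften → ¬ MatrixMultiplication`.**
`HypSuperquadratic` gives `δ > 0` and, for each `n₀`, an `n ≥ n₀` with a method `(h, e, Φ, k)`
certifying `k·n^(2+δ) < Rank_h(Φ⟨n,n,n⟩)`; `HypSoundness` bounds `Rank_h(Φ⟨n,n,n⟩) ≤ k·R(⟨n,n,n⟩)`;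
cancelling `k ≥ 0` (`lt_of_mul_lt_mul_left`) yields `n^(2+δ) < R(⟨n,n,n⟩)`, the hypothesis of
`SuperquadraticInfinitelyOften`, which concludes `¬ MatrixMultiplication`. [folklore] -/
theorem hyperbolicRankMethods_assembly_proof :
    Summit.MatrixMultiplication.MatrixMultiplication.Theses.HyperbolicRankMethods.Assembly := by
  unfold Summit.MatrixMultiplication.MatrixMultiplication.Theses.HyperbolicRankMethods.Assembly
    Summit.MatrixMultiplication.MatrixMultiplication.Theses.HyperbolicRankMethods.HypSuperquadratic
    Summit.MatrixMultiplication.MatrixMultiplication.Theses.HyperbolicRankMethods.HypSoundness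
    Summit.MatrixMultiplication.MatrixMultiplication.Theses.HyperbolicRankMethods.SuperquadraticInfinitelyOften
  rintro ⟨δ, hδ, hX⟩ hS hIO
  refine hIO ⟨δ, hδ, fun n₀ => ?_⟩
  obtain ⟨n, hn, N, d, k, h, e, Φ, hhom, he, -, hsub, hone, hval⟩ := hX n₀
  refine ⟨n, hn, ?_⟩
  have h1 := hS N d k h e Φ hhom he hsub hone (matMulTensor ℂ n n n)
  have h2 : ((d - (MvPolynomial.aeval (fun i => Polynomial.C (Φ (matMulTensor ℂ n n n) i)
      + Polynomial.C (e i) * Polynomial.X) h).natTrailingDegree : ℕ) : ℝ)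
      ≤ (k : ℝ) * (tensorRank (matMulTensor ℂ n n n) : ℝ) := by
    exact_mod_cast h1
  exact lt_of_mul_lt_mul_left (hval.trans_le h2) (Nat.cast_nonneg k)

end Summit.MatrixMultiplication.MatrixMultiplication.Theorems
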